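import Summits.BirchSwinnertonDyer.BirchSwinnertonDyer.Theorems.SignedLowerHalvesSmallImageMuZeroOneSignFinePivotOneSign
import Summits.BirchSwinnertonDyer.BirchSwinnertonDyer.Theorems.KatoDescentPotSupersingularWildFineSelmerSupersingularCMAnchor
import HarnessLib

/-!
# Route `SignedLowerHalves` (K3), crux M `SmallImageMuZeroOneSign` (item stmt-BirchSwinnertonDyer-23600), line `birth_mu` v3 —
# the converse CLOSED: M's body at a pair ⟹ `ConjAAt W p` (modulo Kobayashi Thm. 1.2), hence **M ⟺ Conjecture A on the class**
# as ONE kernel `Iff` modulo the four printed binders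

LEAD seat `cruxlead-stmt-BirchSwinnertonDyer-23600` gen 3 (cell `bsd-ssimc`; `--supports stmt-BirchSwinnertonDyer-23600`, helper).
HONEST FRAMING: THEOREMS ONLY (no definition, no named fact, no instance, no `sorry`); CONDITIONAL theorems, binders displayed and
never discharged: Kobayashi 2003 Thm. 1.2 (`h12`), the two Kurihara–Pollack 2007 sentences (`hKP`, `hKo`) and Matar 2020 / Wingberg
(`hMa`).  Crux M, crux 4, Conjecture A and BSD are NOT proved; nothing is booked.

WHAT.  Gen 2 proved `SmallImageFinePivot.oneSignMuZero_of_conjAAt` (Conjecture A at the pair ⟹ M's body, mod `hKP hKo hMa`) and the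
converse `fineMuZeroAt_of_oneSignMuZero` (M's body ⟹ the POINTWISE fine `μ = 0`, `FineMuZeroAt W p`, mod `h12`).  The tree's node for
Conjecture A at a pair is the `∃`-form `Rank1Residual.ConjAAt W p` («over every cyclotomic `κ` SOME dual fine datum is finitely
generated over `ℤ_p`»), and `ConjAAt → FineMuZeroAt` is the tree's T0 (`ConjAAt.fineMuZeroAt`); the step `FineMuZeroAt → ConjAAt`
needs a finitely generated TORSION fine datum at ONE normalised cyclotomic datum and the transport of «`Sel₀[p]` finite» along
`ker κ₀ = ker κ`.  This file supplies it on the crux's rows (good supersingular odd `p`, `a_p = 0`, where `h12` makes `X^ε`, hence its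
quotient `X₀`, finitely generated torsion):

* `conjAAt_of_fineMuZeroAt` — `h12` ∧ `FineMuZeroAt W p` ⟹ `ConjAAt W p` (normalised datum `exists_isCyclotomic_isTopGenerator_isCyclotomicVariable_holds`;
  `X₀` f.g. torsion as a quotient of `X^ε` — `SignedSelmerDualData.fineDual_moduleFinite` / `…_isTorsion`; `μ(X₀) = 0 ⟺ ℤ_p`-finite —
  `muInvariant_eq_zero_iff_holds`; `Sel₀[p]` finite — `finite_pTorsion_of_fineSelmerDualData_moduleFinite`; transport
  `finite_fineSelmerInfty_pTorsion_of_kerSubgroup_eq`; (A) — `FineSelmerLeSignedSelmer.conjA_of_finite_fineSelmerInfty_pTorsion`).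
* `fineMuZeroAt_iff_conjAAt` — so on these rows `FineMuZeroAt W p ↔ ConjAAt W p` (mod `h12`).
* `conjAAt_of_oneSignMuZero` — **M's body at the pair ⟹ `ConjAAt W p`** (mod `h12`).
* `oneSignMuZero_iff_conjAAt` — **M's body at the pair ⟺ `ConjAAt W p`** (mod `h12 hKP hKo hMa`).
* `smallImageMuZeroOneSign_iff_conjA_onDomain` — **crux M BY NAME ⟺ Conjecture A on its whole domain** (mod the four prints): the exact
  DEDUP certificate for the planner's option (ε′) «file `stub_conjA_ns_ge5` by signature»: an item with that signature and crux M
  decide each other (the `p = 3` rows of Conjecture A on the domain follow from gen 0's print-only theorem through this converse: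
  `conjA_onDomain_three_of_facts`).
READING FOR THE PEN (D-0014; numbers): modulo h12/hKP/hKo/hMa (published, HELD) the items «M» and «Conj A on the small-image ss X7
class» are the SAME statement in the kernel; at `p = 3` both are proved modulo the five prints of gen 0.

References: [CoatesSujatha2005] §3 Conjecture A, Lemma 3.1; [Kobayashi2003] Thm. 1.2, (7.21); [KuriharaPollack2007] §1.2, §3 p. 328;
[Matar2020] Thm. 1.1; [Washington1997] §13.1–13.2; [GreenbergLNM1716] §1 p. 60.
-/

set_option autoImplicit false
set_option linter.dupNamespace false

noncomputable section

open scoped Classical MatrixGroups ModularForm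

namespace Summit.BirchSwinnertonDyer.BirchSwinnertonDyer.Theorems.SmallImageFinePivot

open Literature.NumberTheory.EllipticCurves Literature.NumberTheory.EllipticCurves.Module
  Literature.NumberTheory.EllipticCurves.IwasawaAlgebra Literature.NumberTheory.EllipticCurves.IwasawaDual
open CongruenceSubgroup WeierstrassCurve Literature.NumberTheory.EllipticCurves.Kobayashi2003
  Literature.NumberTheory.EllipticCurves.Rank1Residual Literature.NumberTheory.EllipticCurves.ModularForms
  ZpExtension Summit.BirchSwinnertonDyer.Rank1Residual.X1.MuLambda
  Summit.BirchSwinnertonDyer.BirchSwinnertonDyer.Theorems.WildFineSelmerSupersingularCMAnchor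

variable {p : ℕ} [Fact p.Prime]

/-! ## §1 `FineMuZeroAt → ConjAAt` on the crux's rows (mod Kobayashi Thm. 1.2) -/

/-- **The pointwise fine `μ = 0` gives statement (A) at the pair** on the good-supersingular rows with `a_p = 0`, `p` odd, GRANTED
Kobayashi Thm. 1.2 (`h12`: every signed dual datum over cyclotomic data is finitely generated torsion — so is its quotient `X₀`).
At the normalised cyclotomic datum `(κ₀, γ₀)` the fine dual `X₀` is f.g. torsion with `μ = 0`, hence `ℤ_p`-finite, hence
`Sel₀(ℚ_∞)[p]` is finite; this set does not depend on `κ` among cyclotomic data (`ker κ = ker κ₀`), and over any `κ` it gives (A).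
[cite: Kobayashi2003, Thm. 1.2, (7.21)] [cite: CoatesSujatha2005, §3 Conjecture A and Lemma 3.1] [cite: Washington1997, §13.1–13.2] -/
theorem conjAAt_of_fineMuZeroAt (h12 : thm12_signedSelmerDual_finite_torsion)
    (W : WeierstrassCurve ℚ) [W.IsElliptic] [W.IsGloballyMinimal] (hp : p ≠ 2)
    (hgood : W.HasGoodReductionAtPrime p) (hap : W.frobeniusTrace p = 0) (hF : FineMuZeroAt W p) : ConjAAt W p := by
  obtain ⟨κ₀, hκ₀, γ₀, hγ₀, hγ₀c⟩ := exists_isCyclotomic_isTopGenerator_isCyclotomicVariable_holds p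
  -- a signed dual datum at the normalised datum is f.g. torsion (Thm. 1.2), hence so is every fine dual datum
  let D : SignedSelmerDualData W κ₀ γ₀ 1 := signedSelmerDualData W κ₀ 1 hγ₀
  obtain ⟨hDf, hDt⟩ := h12 W p hp hgood hap κ₀ γ₀ hκ₀ hγ₀ 1 D
  haveI := hDf
  obtain ⟨Y⟩ := W.nonempty_fineSelmerDualData κ₀ hγ₀
  have hYf : Module.Finite (IwasawaAlgebra p) Y.X := D.fineDual_moduleFinite hγ₀ Y
  have hYt : Module.IsTorsion (IwasawaAlgebra p) Y.X := D.fineDual_isTorsion hγ₀ Y hDt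
  -- pointwise fine `μ = 0` ⟹ `X₀` is `ℤ_p`-finite ⟹ `Sel₀[p]` finite at `κ₀`
  have hμ : muInvariant p Y.X = 0 := hF κ₀ γ₀ hκ₀ hγ₀ hγ₀c Y hYf hYt
  have hZp : Module.Finite ℤ_[p] (RestrictScalars ℤ_[p] (IwasawaAlgebra p) Y.X) :=
    (muInvariant_eq_zero_iff_holds p Y.X hYt).mp hμ
  have h0₀ : Set.Finite {s : W.fineSelmerInfty κ₀ | p • s = 0} :=
    IwasawaModuleFinitePadicInt.finite_pTorsion_of_fineSelmerDualData_moduleFinite W κ₀ Y hZp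
  -- transport to every cyclotomic `κ` and conclude (A) there
  intro κ hκ
  have h0 : Set.Finite {s : W.fineSelmerInfty κ | p • s = 0} :=
    finite_fineSelmerInfty_pTorsion_of_kerSubgroup_eq W (IsCyclotomic.kerSubgroup_eq hκ₀ hκ) h0₀
  obtain ⟨γ, hγ⟩ : ∃ γ : Field.absoluteGaloisGroup ℚ, κ.IsTopGenerator γ := κ.surjective (Multiplicative.ofAdd 1)
  exact FineSelmerLeSignedSelmer.conjA_of_finite_fineSelmerInfty_pTorsion W κ hγ h0

/-- **`FineMuZeroAt W p ↔ ConjAAt W p`** on the good-supersingular rows with `a_p = 0`, `p` odd (mod Kobayashi Thm. 1.2; the ← direction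
is the tree's unconditional T0 `ConjAAt.fineMuZeroAt`). [cite: CoatesSujatha2005, §3 statement (A), both forms] [cite: Kobayashi2003, Thm. 1.2] -/
theorem fineMuZeroAt_iff_conjAAt (h12 : thm12_signedSelmerDual_finite_torsion)
    (W : WeierstrassCurve ℚ) [W.IsElliptic] [W.IsGloballyMinimal] (hp : p ≠ 2)
    (hgood : W.HasGoodReductionAtPrime p) (hap : W.frobeniusTrace p = 0) : FineMuZeroAt W p ↔ ConjAAt W p :=
  ⟨conjAAt_of_fineMuZeroAt h12 W hp hgood hap, ConjAAt.fineMuZeroAt⟩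

/-! ## §2 M's body at the pair ⟺ `ConjAAt W p` -/

/-- **M's body at the pair ⟹ `ConjAAt W p`** (mod Kobayashi Thm. 1.2): gen 2's converse `fineMuZeroAt_of_oneSignMuZero` composed with
`conjAAt_of_fineMuZeroAt`. [cite: Kobayashi2003, Thm. 1.2, (7.21)] [cite: CoatesSujatha2005, §3 Conjecture A] -/
theorem conjAAt_of_oneSignMuZero (h12 : thm12_signedSelmerDual_finite_torsion)
    (W : WeierstrassCurve ℚ) [W.IsElliptic] [W.IsGloballyMinimal] (hp : p ≠ 2)
    (hgood : W.HasGoodReductionAtPrime p) (hap : W.frobeniusTrace p = 0)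
    (hM : ∃ ε : ℤˣ, ∀ (κ : ZpExtension ℚ p) (γ : Field.absoluteGaloisGroup ℚ), κ.IsCyclotomic → κ.IsTopGenerator γ →
      IsCyclotomicVariable p γ → ∀ (D : SignedSelmerDualData W κ γ ε) (ξ : IwasawaAlgebra p),
        D.charIdeal = Ideal.span {ξ} → mu ξ = 0) :
    ConjAAt W p :=
  conjAAt_of_fineMuZeroAt h12 W hp hgood hap (fineMuZeroAt_of_oneSignMuZero h12 W hp hgood hap hM)

/-- **M's body at the pair ⟺ `ConjAAt W p`**, modulo the four printed binders (`h12`; `hKP hKo hMa` for →'s converse, gen 2's lever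
`oneSignMuZero_of_conjAAt`).  No `L`-function, no main conjecture, no image hypothesis. [cite: CoatesSujatha2005, §3 Conjecture A]
[cite: Kobayashi2003, Thm. 1.2] [cite: KuriharaPollack2007, §1.2, §3 p. 328] [cite: Matar2020, Thm. 1.1] -/
theorem oneSignMuZero_iff_conjAAt (h12 : thm12_signedSelmerDual_finite_torsion)
    (hKP : kuriharaPollack2007_selmerDual_extension_of_fineDual) (hKo : signedSelmerInf_sub_fineSelmer_of_loc)
    (hMa : matar2020_thm11_selmerDualTorsion_pseudoIso_fineSelmerDual)
    (W : WeierstrassCurve ℚ) [W.IsElliptic] [W.IsGloballyMinimal] (hp : p ≠ 2)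
    (hgood : W.HasGoodReductionAtPrime p) (hap : W.frobeniusTrace p = 0) :
    (∃ ε : ℤˣ, ∀ (κ : ZpExtension ℚ p) (γ : Field.absoluteGaloisGroup ℚ), κ.IsCyclotomic → κ.IsTopGenerator γ →
      IsCyclotomicVariable p γ → ∀ (D : SignedSelmerDualData W κ γ ε) (ξ : IwasawaAlgebra p),
        D.charIdeal = Ideal.span {ξ} → mu ξ = 0) ↔ ConjAAt W p :=
  ⟨conjAAt_of_oneSignMuZero h12 W hp hgood hap, oneSignMuZero_of_conjAAt hKP hKo hMa W hp hgood hap⟩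

/-! ## §3 Crux M BY NAME ⟺ Conjecture A on its domain -/

/-- **CRUX M `SmallImageMuZeroOneSign` BY NAME ⟺ Conjecture A on its whole domain** (every odd `p`, `ClassX7`, non-CM, `a_p = 0`,
`¬ Surj`), modulo the four printed binders.  The DEDUP certificate for the planner's option (ε′): an item carrying the right-hand side
restricted to `5 ≤ p` (`stub_conjA_ns_ge5`'s signature) together with the `p = 3` rows (`conjA_onDomain_three_of_facts`, print-only)
decides M, and M decides it. [cite: CoatesSujatha2005, §3 Conjecture A] [cite: Kobayashi2003, Thm. 1.2] [cite: KuriharaPollack2007, §3 p. 328]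
[cite: Matar2020, Thm. 1.1] -/
theorem smallImageMuZeroOneSign_iff_conjA_onDomain (h12 : thm12_signedSelmerDual_finite_torsion)
    (hKP : kuriharaPollack2007_selmerDual_extension_of_fineDual) (hKo : signedSelmerInf_sub_fineSelmer_of_loc)
    (hMa : matar2020_thm11_selmerDualTorsion_pseudoIso_fineSelmerDual) :
    Summit.BirchSwinnertonDyer.BirchSwinnertonDyer.Theses.SignedLowerHalves.SmallImageMuZeroOneSign ↔
      ∀ (W : WeierstrassCurve ℚ) [W.IsElliptic] [W.IsGloballyMinimal] (p : ℕ) [Fact p.Prime],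
        p ≠ 2 → ClassX7 W p → ¬ W.HasCM → W.frobeniusTrace p = 0 → ¬ Surj W p → ConjAAt W p := by
  constructor
  · intro hM W _ _ p _ hp hX hCM hap hs
    exact conjAAt_of_oneSignMuZero h12 W hp hX.1.1 hap (hM W p hp hX hCM hap hs)
  · exact smallImageMuZeroOneSign_of_facts_of_conjA hKP hKo hMa

/-- **Conjecture A on the `p = 3` rows of the domain, modulo PRINT ONLY** (the five binders of gen 0's
`SmallImageMuControl.smallImageMuZeroOneSign_three_of_facts` — THEOREM B at 3 + lane B's `μ`-transfer — pushed through the converse):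
at every small-image X7 pair with `p = 3` (`a_3 = 0`), `ConjAAt W 3`. [cite: CoatesSujatha2005, §3 Conjecture A]
[cite: Kobayashi2003, Thm. 1.2, Thm. 6.2–6.3, Thm. 7.3] [cite: PollackWeston2011, Thm. 4.1 (1)] -/
theorem conjA_onDomain_three_of_facts
    (hCK : thm62_63_73_signedColemanKato_zeta) (h12 : thm12_signedSelmerDual_finite_torsion)
    (h5 : realPeriodRat_eq_unit_mul_plusPeriod) (h3 : realPeriodRat_eq_unit_mul_plusPeriod_three)
    (hmodP : nonempty_modularParametrizationData) :
    ∀ (W : WeierstrassCurve ℚ) [W.IsElliptic] [W.IsGloballyMinimal] (p : ℕ) [Fact p.Prime],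
      p = 3 → ClassX7 W p → ¬ W.HasCM → W.frobeniusTrace p = 0 → ¬ Surj W p → ConjAAt W p := by
  intro W _ _ p _ hp3 hX hCM hap hs
  have hp : p ≠ 2 := by omega
  exact conjAAt_of_oneSignMuZero h12 W hp hX.1.1 hap
    (SmallImageMuControl.smallImageMuZeroOneSign_three_of_facts hCK h12 h5 h3 hmodP W p hp3 hX hCM hap hs)

/-- **Crux M BY NAME ⟺ its `p ≥ 5` open stub `stub_conjA_ns_ge5`** (TEXT verbatim), modulo the EIGHT printed binders (gen 0's five for
the `p = 3` rows, gen 2's three + `h12` already among them): the registered open stub of line `birth_mu` v3 IS the crux, in the kernel.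
[cite: CoatesSujatha2005, §3 Conjecture A] [cite: Kobayashi2003, Thm. 1.2, Thm. 6.2–6.3, Thm. 7.3] [cite: KuriharaPollack2007, §3 p. 328] [cite: Matar2020, Thm. 1.1] -/
theorem smallImageMuZeroOneSign_iff_stub_conjA_ns_ge5
    (hCK : thm62_63_73_signedColemanKato_zeta) (h12 : thm12_signedSelmerDual_finite_torsion)
    (h5 : realPeriodRat_eq_unit_mul_plusPeriod) (h3 : realPeriodRat_eq_unit_mul_plusPeriod_three)
    (hmodP : nonempty_modularParametrizationData)
    (hKP : kuriharaPollack2007_selmerDual_extension_of_fineDual) (hKo : signedSelmerInf_sub_fineSelmer_of_loc)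
    (hMa : matar2020_thm11_selmerDualTorsion_pseudoIso_fineSelmerDual) :
    Summit.BirchSwinnertonDyer.BirchSwinnertonDyer.Theses.SignedLowerHalves.SmallImageMuZeroOneSign ↔
      ∀ (W : WeierstrassCurve ℚ) [W.IsElliptic] [W.IsGloballyMinimal] (p : ℕ) [Fact p.Prime],
        5 ≤ p → ClassX7 W p → ¬ W.HasCM → W.frobeniusTrace p = 0 → ¬ Surj W p → ConjAAt W p := by
  constructor
  · intro hM W _ _ p _ hp5 hX hCM hap hs
    exact (smallImageMuZeroOneSign_iff_conjA_onDomain h12 hKP hKo hMa).mp hM W p (by omega) hX hCM hap hs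
  · exact smallImageMuZeroOneSign_of_facts_of_conjA_ge_five hCK h12 h5 h3 hmodP hKP hKo hMa

end Summit.BirchSwinnertonDyer.BirchSwinnertonDyer.Theorems.SmallImageFinePivot

end
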